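import Mathlib
import Literature.NumberTheory.LFunctions.Zhang2022.TypedSection12B
import Literature.NumberTheory.LFunctions.Zhang2022.Section12Ded1217Sizes
import Literature.NumberTheory.LFunctions.Zhang2022.Section11XiZeroTrueSize
import Literature.NumberTheory.LFunctions.Zhang2022.AppendixAEulerProductU004
import Literature.NumberTheory.LFunctions.Zhang2022.Section4GaussianWeight
import Literature.NumberTheory.Sieve.ShiuDivisorClass
import HarnessLib

/-!
# Zhang (2022) §12 u030, smoothing step — lemmas: the Gaussian profile, the `ξ₀ⱼ` window mean
# (Shiu), and the numerical endgame

Topic `Literature/NumberTheory/LFunctions/Zhang2022` (Landau–Siegel audit tree; verdict-neutral).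
Y. Zhang, *Discrete mean estimates and the Landau–Siegel zero*, arXiv:2211.02515v1 (2022)
[Zhang2022LandauSiegel] — **an unrefereed manuscript under adjudication**; ZHANG-L lane WP12, helper
lemmas for the "(4.2)–(4.3)" smoothing step of the proof of Lemma 12.3 (§12 p.70 via p.69 u024), used by
`Section12U030Smoothing` (theorem `innerSumLow_sub_smooth_le`). Nothing here asserts or denies
Theorems 1–2 of the manuscript; no Zhang step is assumed. Contents (all PROVED):

* `abs_indicator_sub_gWeight_le` — `|𝟙_{l<x} − g_Λ(x/l)| ≤ ½e^{−Λlog²(x/l)}` ((4.2)–(4.3),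
  `GaussWeight.abs_gWeight_sub_one_le`, `gWeight_le`);
* `norm_xiZero_le_pow_fourteen` — the crude `‖ξ₀ⱼ(n;d,r)‖ ≤ n¹⁴` (from `Lemma83.norm_xiZero_le`);
* `xiZero_window_logMean_le` — **Shiu's theorem for the divisor class** (`Sieve.ShiuDivisorClass`,
  `a = 2`, `d = 3`, `C₅ = 1806`) applied to the MULTIPLICATIVE `n ↦ ‖ξ₀ⱼ(n;d,r)‖`
  (`Lemma83.xiZero_mul_of_coprime`; primes `XiZeroMajorant.norm_xiZero_prime_le_of_(not_)dvd`, prime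
  powers `Lemma83.norm_xiZero_prime_pow_le`): `Σ_{x<n≤x'} ‖ξ₀ⱼ(n;d,r)‖/n ≤ C((x'−x)/x)log x`, uniformly
  in `j, d, r`;
* `norm_term_le`, `pow_mul_gauss_le_tail`, `tsum_inv_sq_le_two`, `window_point_bounds`
  (`T¹⁰ ≤ P″₂/dr ≤ P` on `P″₁ < dr < P₂`) and the real-variable endgame lemmas.

## References

* Y. Zhang, arXiv:2211.02515v1 (2022), §12 pp.69–70; §4 (4.1)–(4.3) p.18; §7 p.33; App. A pp.102–103.
  [cite: Zhang2022LandauSiegel, §12 pp.69–70; §4 (4.1)–(4.3)]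
* P. Shiu, J. reine angew. Math. 313 (1980), Thm 1. [cite: Shiu1980, Theorem 1]
-/

noncomputable section

open Complex Real Finset

namespace Literature.NumberTheory.LFunctions.Zhang2022.Typed.Sec12B

open Literature.NumberTheory.LFunctions.Zhang2022.Skeleton
open Literature.NumberTheory.LFunctions.Zhang2022.GaussWeight

/-! ## Pointwise facts -/

/-- **The smoothing profile**: for `Λ > 0`, `x > 0` and an integer `l ≥ 1`,
`|𝟙_{l<x} − g_Λ(x/l)| ≤ ½e^{−Λlog²(x/l)}` ((4.2) for `l < x`, (4.3) for `l ≥ x`).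
[cite: Zhang2022LandauSiegel, §4 (4.2)–(4.3) p.18] -/
theorem abs_indicator_sub_gWeight_le {Λ x : ℝ} (hΛ : 0 < Λ) (hx : 0 < x) {l : ℕ} (hl : 1 ≤ l) :
    |(if (l : ℝ) < x then (1 : ℝ) else 0) - gWeight Λ (x / l)| ≤
      (1 / 2) * rexp (-Λ * Real.log (x / l) ^ 2) := by
  have hl0 : (0 : ℝ) < l := by exact_mod_cast hl
  have hxl : 0 < x / l := div_pos hx hl0
  split_ifs with h
  · have h1 : 1 ≤ x / l := by rw [le_div_iff₀ hl0, one_mul]; exact h.le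
    rw [abs_sub_comm]
    exact abs_gWeight_sub_one_le hΛ h1
  · push Not at h
    have h1 : x / l ≤ 1 := by rw [div_le_one hl0]; exact h
    rw [zero_sub, abs_neg, abs_of_pos (gWeight_pos hΛ _)]
    exact gWeight_le hΛ hxl h1

/-- **Crude polynomial bound `‖ξ₀ⱼ(n;d,r)‖ ≤ n¹⁴`** (`n, d, r ≥ 1`): from `‖ξ₀ⱼ(n)‖ ≤ 1806^{ω(n)}τ(n)³`
(`Lemma83.norm_xiZero_le`), `1806 < 2¹¹`, `2^{ω(n)} ≤ τ(n) ≤ n`. [cite: Zhang2022LandauSiegel, App. A pp.102–103] -/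
theorem norm_xiZero_le_pow_fourteen (c' : ℝ) (D j : ℕ) {d r n : ℕ} (hd : d ≠ 0) (hr : r ≠ 0)
    (hn : n ≠ 0) : ‖xiZero c' D j n d r‖ ≤ (n : ℝ) ^ 14 := by
  have h := Lemma83.norm_xiZero_le c' D (j := j) hd hr hn
  have hτ : (n.divisors.card : ℝ) ≤ n := by exact_mod_cast Nat.card_divisors_le_self n
  have hω : (1806 : ℝ) ^ n.primeFactors.card ≤ (n : ℝ) ^ 11 := by
    -- `2^{ω(n)} ≤ τ(n) ≤ n`
    have h2 : 2 ^ n.primeFactors.card ≤ n.divisors.card := by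
      rw [Nat.card_divisors hn, ← Finset.prod_const]
      refine Finset.prod_le_prod' fun p hp => ?_
      have := (Nat.prime_of_mem_primeFactors hp).factorization_pos_of_dvd hn
        (Nat.dvd_of_mem_primeFactors hp)
      omega
    have h3 : ((2 : ℝ) ^ n.primeFactors.card) ≤ n := by
      exact_mod_cast h2.trans (Nat.card_divisors_le_self n)
    calc (1806 : ℝ) ^ n.primeFactors.card ≤ ((2 : ℝ) ^ 11) ^ n.primeFactors.card :=
          pow_le_pow_left₀ (by norm_num) (by norm_num) _
      _ = ((2 : ℝ) ^ n.primeFactors.card) ^ 11 := by rw [← pow_mul, mul_comm, pow_mul]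
      _ ≤ (n : ℝ) ^ 11 := pow_le_pow_left₀ (by positivity) h3 _
  calc ‖xiZero c' D j n d r‖ ≤ (1806 : ℝ) ^ n.primeFactors.card * (n.divisors.card : ℝ) ^ 3 := h
    _ ≤ (n : ℝ) ^ 11 * (n : ℝ) ^ 3 := by
        gcongr
    _ = (n : ℝ) ^ 14 := by ring


/-! ## The window: Shiu's theorem for `n ↦ ‖ξ₀ⱼ(n;d,r)‖` -/

/-- **Short logarithmic means of `|ξ₀ⱼ(·;d,r)|` are `O(relative length · log x)`**, uniformly in
`j, d, r`: there are absolute `C, x₀` such that for `D ≥ ⌈e^{5|c′|π+3}⌉` (so `21B·log(4P) ≤ 378π`),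
`x₀ ≤ x ≤ P`, `x + x^{1/4} ≤ x' ≤ 2x`: `Σ_{x<n≤x'} ‖ξ₀ⱼ(n;d,r)‖/n ≤ C·((x'−x)/x)·log x` — Shiu's theorem
for the divisor class (`a = 2`, `d = 3`, `C₅ = 1806`) applied to the multiplicative `‖ξ₀ⱼ(·;d,r)‖`
(`≤ 2 + 21B log q + M_x/q` at primes, `≤ 1806(ν+1)³` at prime powers).
[cite: Zhang2022LandauSiegel, §7 p.33; App. A pp.102–103] [cite: Shiu1980, Theorem 1] -/
theorem xiZero_window_logMean_le (c' : ℝ) : ∃ C x₀ : ℝ, 0 ≤ C ∧ 2 ≤ x₀ ∧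
    ∀ (D : ℕ), ⌈Real.exp (5 * |c'| * π + 3)⌉₊ ≤ D → ∀ (j d r : ℕ), d ≠ 0 → r ≠ 0 →
      ∀ x x' : ℝ, x₀ ≤ x → x + x ^ (1 / 4 : ℝ) ≤ x' → x' ≤ 2 * x → x ≤ bigP D →
        ∑ n ∈ Finset.Ioc ⌊x⌋₊ ⌊x'⌋₊, ‖xiZero c' D j n d r‖ / n ≤ C * ((x' - x) / x) * Real.log x := by
  obtain ⟨C, x₀, hC0, hx₀, hS⟩ :=
    Literature.NumberTheory.Sieve.ShiuDivisorClass.shiu_divisor_class_logMean_Ioc 2 3 1806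
  set Mx : ℝ := 12 + 56 * LogEulerProduct.tailConst 3 with hMx
  have hMx0 : 0 ≤ Mx := by
    rw [hMx]; linarith [LogEulerProduct.tailConst_nonneg 3]
  refine ⟨C * Real.exp (378 * π + Mx), x₀, by positivity, hx₀, ?_⟩
  intro D hD j d r hd hr x x' hx hxx' hx'x hxP
  obtain ⟨hL3, hBle⟩ := XiZeroMajorant.three_le_ell_and_Bsum_le hD
  have hB0 : 0 ≤ XiZeroMajorant.Bsum c' D := XiZeroMajorant.Bsum_nonneg c' D
  have hx2 : 2 ≤ x := le_trans hx₀ hx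
  have hlogx : 0 < Real.log x := Real.log_pos (by linarith)
  -- the multiplicative function `f(n) = ‖ξ₀ⱼ(n;d,r)‖`
  set f : ℕ → ℝ := fun n => ‖xiZero c' D j n d r‖ with hf
  have hf0 : ∀ n, 0 ≤ f n := fun n => norm_nonneg _
  have hmul : ∀ m n : ℕ, m.Coprime n → f (m * n) = f m * f n := by
    intro m n hmn
    simp only [hf]
    rw [Lemma83.xiZero_mul_of_coprime c' D j hd hr hmn, norm_mul]
  have hpow : ∀ p ν : ℕ, p.Prime → 1 ≤ ν → f (p ^ ν) ≤ 1806 * ((ν : ℝ) + 1) ^ 3 := by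
    intro p ν hp hν
    exact Lemma83.norm_xiZero_prime_pow_le c' D (j := j) hp (by omega) d r
  set K : ℝ := 21 * XiZeroMajorant.Bsum c' D with hK
  have hK0 : 0 ≤ K := by positivity
  have hprime : ∀ p : ℕ, p.Prime → (p : ℝ) ≤ x → f p ≤ (2 : ℕ) + K * Real.log p + Mx / p := by
    intro p hp _
    have hp2 : (2 : ℝ) ≤ p := by exact_mod_cast hp.two_le
    have hlogp : 0 ≤ Real.log p := Real.log_nonneg (by linarith)
    have hMp : 0 ≤ Mx / p := div_nonneg hMx0 (by linarith)
    by_cases hpr : p ∣ r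
    · have h := XiZeroMajorant.norm_xiZero_prime_le_of_dvd c' D hp j (d := d) hpr
      simp only [hf]
      refine h.trans ?_
      rw [hK]; push_cast
      nlinarith [mul_nonneg hB0 hlogp]
    · have h := XiZeroMajorant.norm_xiZero_prime_le_of_not_dvd c' D hp j (d := d) hpr
      simp only [hf]
      refine h.trans ?_
      rw [hK, hMx]; push_cast
      nlinarith [mul_nonneg hB0 hlogp]
  have h := hS f hf0 hmul hpow K Mx hK0 hMx0 x x' hx hxx' hx'x hprime
  -- `K log(4x) ≤ 378π`
  have hL0 : 0 < ell D := by linarith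
  have hL9 : 0 < ell D ^ 9 := pow_pos hL0 9
  have hP : Real.log (4 * x) ≤ 2 * ell D ^ 9 := by
    have h4x : 0 < 4 * x := by linarith
    have h1 : Real.log (4 * x) ≤ Real.log (4 * bigP D) :=
      Real.log_le_log h4x (by linarith)
    rw [bigP, Real.log_mul (by norm_num) (Real.exp_pos _).ne', Real.log_exp] at h1
    have h4 : Real.log 4 ≤ ell D ^ 9 := by
      have : Real.log 4 ≤ 4 := by
        have := Real.log_le_sub_one_of_pos (show (0:ℝ) < 4 by norm_num); linarith
      have h27 : (3 : ℝ) ^ 9 ≤ ell D ^ 9 := pow_le_pow_left₀ (by norm_num) hL3 9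
      linarith
    linarith
  have hKlog : K * Real.log (4 * x) + Mx ≤ 378 * π + Mx := by
    have : K * Real.log (4 * x) ≤ 21 * (9 * π / ell D ^ 9) * (2 * ell D ^ 9) := by
      have hlog4x : 0 ≤ Real.log (4 * x) := Real.log_nonneg (by linarith)
      calc K * Real.log (4 * x) ≤ 21 * (9 * π / ell D ^ 9) * Real.log (4 * x) := by
            rw [hK]; gcongr
        _ ≤ 21 * (9 * π / ell D ^ 9) * (2 * ell D ^ 9) := by gcongr
    have h2 : 21 * (9 * π / ell D ^ 9) * (2 * ell D ^ 9) = 378 * π := by field_simp; ring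
    linarith
  have hxx0 : 0 ≤ (x' - x) / x := div_nonneg (by
    have : 0 ≤ x ^ (1/4 : ℝ) := Real.rpow_nonneg (by linarith) _
    linarith) (by linarith)
  calc ∑ n ∈ Finset.Ioc ⌊x⌋₊ ⌊x'⌋₊, f n / n
      ≤ C * Real.exp (K * Real.log (4 * x) + Mx) * ((x' - x) / x) * Real.log x ^ (2 : ℕ) /
          Real.log x := h
    _ = C * Real.exp (K * Real.log (4 * x) + Mx) * ((x' - x) / x) * Real.log x := by
        field_simp
    _ ≤ C * Real.exp (378 * π + Mx) * ((x' - x) / x) * Real.log x := by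
        gcongr


/-! ## Auxiliary pointwise estimates -/

/-- The size of one term: `‖χ(l)ξ₀ⱼ(l;d,r)l^{−(1−β₆+w)}‖ ≤ ‖ξ₀ⱼ(l)‖·l⁻¹·l^{α}` for `l ≥ 1`, `‖w‖ ≤ α`
(`Re(1−β₆+w) = 1 + Re w ≥ 1 − α`). [cite: Zhang2022LandauSiegel, §12 p.70] -/
theorem norm_term_le (c' : ℝ) {D : ℕ} [NeZero D] (χ : DirichletCharacter ℂ D) (j d r : ℕ)
    {l : ℕ} (hl : 1 ≤ l) {w : ℂ} {α : ℝ} (hw : ‖w‖ ≤ α) :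
    ‖χ (l : ZMod D) * xiZero c' D j l d r / (l : ℂ) ^ (1 - beta6 D + w)‖ ≤
      ‖xiZero c' D j l d r‖ * ((l : ℝ)⁻¹ * (l : ℝ) ^ α) := by
  have hl0 : (0 : ℝ) < l := by exact_mod_cast hl
  have hl1 : (1 : ℝ) ≤ l := by exact_mod_cast hl
  have hre : (1 - beta6 D + w).re = 1 + w.re := by
    simp [Typed.Sec12A.beta6_re]
  rw [norm_div, norm_mul, Complex.norm_natCast_cpow_of_pos (by omega), hre]
  have hχ : ‖χ (l : ZMod D)‖ ≤ 1 := DirichletCharacter.norm_le_one χ _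
  have hwre : -w.re ≤ α := by
    have := Complex.abs_re_le_norm w
    have h2 : |w.re| ≤ α := this.trans hw
    linarith [neg_abs_le (w.re), (abs_le.mp h2).1]
  have hpow : (l : ℝ) ^ (1 + w.re) = (l : ℝ) * (l : ℝ) ^ w.re := by
    rw [Real.rpow_add hl0, Real.rpow_one]
  have hden : 0 < (l : ℝ) ^ (1 + w.re) := Real.rpow_pos_of_pos hl0 _
  rw [div_le_iff₀ hden, hpow]
  have hinv : (l : ℝ) ^ w.re * (l : ℝ) ^ α ≥ 1 := by
    rw [← Real.rpow_add hl0]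
    exact Real.one_le_rpow hl1 (by linarith)
  have hξ : 0 ≤ ‖xiZero c' D j l d r‖ := norm_nonneg _
  calc ‖χ (l : ZMod D)‖ * ‖xiZero c' D j l d r‖ ≤ 1 * ‖xiZero c' D j l d r‖ := by gcongr
    _ = ‖xiZero c' D j l d r‖ * 1 := by ring
    _ ≤ ‖xiZero c' D j l d r‖ * ((l : ℝ) ^ w.re * (l : ℝ) ^ α) :=
        mul_le_mul_of_nonneg_left hinv hξ
    _ = ‖xiZero c' D j l d r‖ * ((l : ℝ)⁻¹ * (l : ℝ) ^ α) * ((l : ℝ) * (l : ℝ) ^ w.re) := by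
        field_simp

/-- The tail: for `Λ ≥ 68`, `1 ≤ x`, `x² ≤ l` and `e ≤ l`:
`l¹⁴·e^{−Λ log²(x/l)} ≤ x⁻²l⁻²` (`log(l/x) ≥ ½log l ≥ ½`). [cite: Zhang2022LandauSiegel, §12 p.70 (proof of Lemma 12.3, smoothing step)] -/
theorem pow_mul_gauss_le_tail {Λ x : ℝ} (hΛ : 68 ≤ Λ) (hx : 1 ≤ x) {l : ℝ} (hxl : x ^ 2 ≤ l)
    (hle : Real.exp 1 ≤ l) :
    l ^ (14 : ℝ) * rexp (-Λ * Real.log (x / l) ^ 2) ≤ x ^ (-2 : ℝ) * l ^ (-2 : ℝ) := by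
  have hl0 : 0 < l := lt_of_lt_of_le (Real.exp_pos 1) hle
  have hx0 : 0 < x := by linarith
  have hlogl : 1 ≤ Real.log l := by
    rw [Real.le_log_iff_exp_le hl0]; exact hle
  have hlogx0 : 0 ≤ Real.log x := Real.log_nonneg hx
  have hlogx : 2 * Real.log x ≤ Real.log l := by
    have := Real.log_le_log (by positivity) hxl
    rwa [Real.log_pow, Nat.cast_ofNat] at this
  have hq : Real.log (x / l) = Real.log x - Real.log l := Real.log_div hx0.ne' hl0.ne'
  have hq2 : (Real.log l / 2) ^ 2 ≤ Real.log (x / l) ^ 2 := by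
    rw [hq]
    have h1 : Real.log l / 2 ≤ Real.log l - Real.log x := by linarith
    have h2 : Real.log l - Real.log x = -(Real.log x - Real.log l) := by ring
    calc (Real.log l / 2) ^ 2 ≤ (Real.log l - Real.log x) ^ 2 :=
          pow_le_pow_left₀ (by linarith) h1 2
      _ = (Real.log x - Real.log l) ^ 2 := by rw [h2, neg_sq]
  rw [Real.rpow_def_of_pos hl0, Real.rpow_def_of_pos hl0, Real.rpow_def_of_pos hx0,
    ← Real.exp_add, ← Real.exp_add, Real.exp_le_exp]
  -- `14 log l − Λ log²(x/l) ≤ −2 log x − 2 log l`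
  have h3 : Λ * Real.log (x / l) ^ 2 ≥ 17 * Real.log l := by
    calc Λ * Real.log (x / l) ^ 2 ≥ 68 * (Real.log l / 2) ^ 2 := by
          have := mul_le_mul hΛ hq2 (by positivity) (by linarith)
          linarith
      _ = 17 * (Real.log l * Real.log l) := by ring
      _ ≥ 17 * (1 * Real.log l) := by gcongr
      _ = 17 * Real.log l := by ring
  nlinarith

/-- `Σ_{n} n⁻² ≤ 2` over `ℕ` (`ζ(2) = π²/6`; the `n = 0` term is `0`). [cite: Zhang2022LandauSiegel, §12 p.70 (proof of Lemma 12.3, smoothing step)] -/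
theorem tsum_inv_sq_le_two : ∑' n : ℕ, ((n : ℝ) ^ 2)⁻¹ ≤ 2 := by
  have h := hasSum_zeta_two.tsum_eq
  simp only [one_div] at h
  rw [h]
  nlinarith [Real.pi_lt_d2, Real.pi_pos]


/-! ## Sizes of the window point `x = P″₂/(dr)` -/

/-- For `P″₁ < dr < P₂`: `T¹⁰ ≤ x := P″₂/(dr) ≤ P` (`P″₂ = P₂·D t₀T¹⁰`, `P″₂/P″₁ = P^{0.004} ≤ P`),
assuming `𝓛 ≥ 1`. [cite: Zhang2022LandauSiegel, §12 p.67, p.70] -/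
theorem window_point_bounds {D : ℕ} (hL : 1 ≤ ell D) {d r : ℕ}
    (h1 : P1pp D < ((d * r : ℕ) : ℝ)) (h2 : ((d * r : ℕ) : ℝ) < Skeleton.P2 D) :
    bigT D ^ 10 ≤ P2pp D / ((d * r : ℕ) : ℝ) ∧ P2pp D / ((d * r : ℕ) : ℝ) ≤ bigP D := by
  have hD1 : 1 ≤ Real.log D := by rw [ell] at hL; exact hL
  have hP1 : 0 < P1pp D := Sec12D.P1pp_pos hD1
  have hP2pp : 0 < P2pp D := Sec12D.P2pp_pos hD1
  have hdr : (0 : ℝ) < ((d * r : ℕ) : ℝ) := lt_trans hP1 h1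
  have hT : 0 < bigT D := Real.exp_pos _
  have hP : 0 < bigP D := Real.exp_pos _
  have ht0 : 1 ≤ t0 D := by rw [t0]; exact one_le_pow₀ hL
  have hDD : (1 : ℝ) ≤ D := by
    have h0 : (0 : ℝ) < D := by
      by_contra h
      push Not at h
      have : Real.log (D : ℝ) ≤ 0 := Real.log_nonpos (Nat.cast_nonneg D) (by linarith)
      linarith
    have : (1 : ℕ) ≤ D := by exact_mod_cast h0
    exact_mod_cast this
  constructor
  · -- `x ≥ P″₂/P₂ = D t₀ T¹⁰ ≥ T¹⁰`
    have hP2 : 0 < Skeleton.P2 D := by rw [Skeleton.P2]; positivity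
    have hx : P2pp D / Skeleton.P2 D ≤ P2pp D / ((d * r : ℕ) : ℝ) :=
      div_le_div_of_nonneg_left hP2pp.le hdr h2.le
    refine le_trans ?_ hx
    rw [le_div_iff₀ hP2, Skeleton.P2, P2pp]
    have hsq : 0 < bigP D ^ (0.5 : ℝ) := Real.rpow_pos_of_pos hP _
    rw [show bigT D ^ 10 * (bigP D ^ (0.5 : ℝ) / bigT D ^ 10) = bigP D ^ (0.5 : ℝ) * 1 * 1 by
      field_simp]
    gcongr
  · -- `x ≤ P″₂/P″₁ = P^{0.004} ≤ P`
    have hx : P2pp D / ((d * r : ℕ) : ℝ) ≤ P2pp D / P1pp D :=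
      div_le_div_of_nonneg_left hP2pp.le hP1 h1.le
    refine hx.trans ?_
    rw [Sec12D.P2pp_div_P1pp hD1]
    have hP1' : 1 ≤ bigP D := Real.one_le_exp (by positivity)
    calc bigP D ^ (0.004 : ℝ) ≤ bigP D ^ (1 : ℝ) :=
          Real.rpow_le_rpow_of_exponent_le hP1' (by norm_num)
      _ = bigP D := Real.rpow_one _

/-! ## Numerical lemmas for the endgame -/

/-- `e^{1/4} ≤ 2` and `e^{1/2} ≤ 2` and `1/2 ≤ e^{−1/4}`. [cite: Zhang2022LandauSiegel, §12 p.70 (proof of Lemma 12.3, smoothing step)] -/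
theorem exp_small_facts : Real.exp (1 / 4 : ℝ) ≤ 2 ∧ Real.exp (1 / 2 : ℝ) ≤ 2 ∧
    (1 / 2 : ℝ) ≤ Real.exp (-(1 / 4 : ℝ)) := by
  have he := Real.exp_one_lt_d9
  have h2 : Real.exp (1 / 2 : ℝ) ≤ 2 := by
    have h3 : Real.exp (1 / 2 : ℝ) ^ 2 = Real.exp 1 := by rw [← Real.exp_nat_mul]; norm_num
    nlinarith [Real.exp_pos (1 / 2 : ℝ)]
  refine ⟨?_, h2, ?_⟩
  · exact le_trans (Real.exp_le_exp.mpr (by norm_num)) h2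
  · have := Real.add_one_le_exp (-(1 / 4 : ℝ)); linarith

/-- `4L³⁶ ≤ e^{10L}` for `L ≥ 45` (from `(10L)⁴²/42! ≤ e^{10L}` and `4·42! ≤ 45⁶·10⁴²`). [cite: Zhang2022LandauSiegel, §12 p.70 (proof of Lemma 12.3, smoothing step)] -/
theorem four_mul_pow_le_exp_ten_mul {L : ℝ} (hL : 45 ≤ L) : 4 * L ^ 36 ≤ Real.exp (10 * L) := by
  have hL0 : 0 ≤ L := by linarith
  have h1 := Real.pow_div_factorial_le_exp (x := 10 * L) (by positivity) 42
  have hf : (0 : ℝ) < Nat.factorial 42 := by positivity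
  rw [div_le_iff₀ hf] at h1
  have h6 : (45 : ℝ) ^ 6 ≤ L ^ 6 := pow_le_pow_left₀ (by norm_num) hL 6
  have hnum : (4 : ℝ) * (Nat.factorial 42 : ℝ) ≤ 45 ^ 6 * 10 ^ 42 := by norm_num [Nat.factorial]
  have h36 : 0 ≤ L ^ 36 := pow_nonneg hL0 36
  -- `4·L³⁶·42! ≤ L³⁶·45⁶·10⁴² ≤ L⁴²·10⁴² = (10L)⁴² ≤ 42!·e^{10L}`
  have h3 : 4 * L ^ 36 * (Nat.factorial 42 : ℝ) ≤ (10 * L) ^ 42 := by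
    calc 4 * L ^ 36 * (Nat.factorial 42 : ℝ) = L ^ 36 * (4 * (Nat.factorial 42 : ℝ)) := by ring
      _ ≤ L ^ 36 * (45 ^ 6 * 10 ^ 42) := mul_le_mul_of_nonneg_left hnum h36
      _ ≤ L ^ 36 * (L ^ 6 * 10 ^ 42) := by gcongr
      _ = (10 * L) ^ 42 := by ring
  nlinarith

/-- The window gap for Shiu: with `δ = L⁻²⁵`, `L ≥ 1` and `x₁ ≥ L³⁶`:
`x₁ + x₁^{1/4} ≤ x₁e^{2δ}` (indeed `x₁^{1/4} ≤ 2δx₁`). [cite: Zhang2022LandauSiegel, §12 p.70 (proof of Lemma 12.3, smoothing step)] -/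
theorem window_gap {L x₁ : ℝ} (hL : 1 ≤ L) (hx₁ : L ^ 36 ≤ x₁) :
    x₁ + x₁ ^ (1 / 4 : ℝ) ≤ x₁ * Real.exp (2 * (L ^ 25)⁻¹) := by
  have hL0 : 0 < L := by linarith
  have hx₁1 : 1 ≤ x₁ := le_trans (one_le_pow₀ hL) hx₁
  have hx₁0 : 0 < x₁ := by linarith
  set δ : ℝ := (L ^ 25)⁻¹ with hδ
  have hδ0 : 0 < δ := by rw [hδ]; positivity
  -- `x₁(e^{2δ} − 1) ≥ 2δx₁`
  have h1 : 2 * δ * x₁ ≤ x₁ * (Real.exp (2 * δ) - 1) := by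
    have := Real.add_one_le_exp (2 * δ)
    nlinarith
  -- `x₁^{1/4} ≤ 2δx₁`
  set y : ℝ := x₁ ^ (1 / 4 : ℝ) with hy
  have hy0 : 0 < y := Real.rpow_pos_of_pos hx₁0 _
  have hy4 : y ^ 4 = x₁ := by
    rw [hy, ← Real.rpow_natCast, ← Real.rpow_mul hx₁0.le]; norm_num
  have hyL : L ^ 9 ≤ y := by
    have : (L ^ 9) ^ 4 ≤ y ^ 4 := by rw [hy4, ← pow_mul]; exact hx₁
    exact le_of_pow_le_pow_left₀ (by norm_num) hy0.le this
  have h2 : y ≤ 2 * δ * x₁ := by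
    rw [← hy4, hδ]
    have hL25 : 0 < L ^ 25 := by positivity
    rw [show 2 * (L ^ 25)⁻¹ * y ^ 4 = 2 * y ^ 4 / L ^ 25 by ring, le_div_iff₀ hL25]
    -- `y·L²⁵ ≤ 2y⁴` since `L²⁵ ≤ L²⁷ ≤ y³`
    have h27 : L ^ 25 ≤ L ^ 27 := pow_le_pow_right₀ hL (by norm_num)
    have hy3 : L ^ 27 ≤ y ^ 3 := by
      calc L ^ 27 = (L ^ 9) ^ 3 := by ring
        _ ≤ y ^ 3 := pow_le_pow_left₀ (by positivity) hyL 3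
    nlinarith [pow_nonneg hy0.le 3]
  linarith

/-- The window piece of the endgame: `e^π·(C·4L⁻²⁵·L⁹) ≤ 4e^πC·L⁻¹⁵` (`L ≥ 1`, `C ≥ 0`). [cite: Zhang2022LandauSiegel, §12 p.70 (proof of Lemma 12.3, smoothing step)] -/
theorem window_piece_le {L C : ℝ} (hL : 1 ≤ L) (hC : 0 ≤ C) :
    Real.exp π * (C * (4 * (L ^ 25)⁻¹) * L ^ 9) ≤ 4 * Real.exp π * C * (L ^ 15)⁻¹ := by
  have hL0 : 0 < L := by linarith
  have hL15 : 0 < L ^ 15 := by positivity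
  have h : (L ^ 25)⁻¹ * L ^ 9 ≤ (L ^ 15)⁻¹ := by
    rw [inv_mul_le_iff₀ (by positivity), ← div_eq_mul_inv, le_div_iff₀ hL15]
    calc L ^ 9 * L ^ 15 = L ^ 24 := by ring
      _ ≤ L ^ 25 := pow_le_pow_right₀ hL (by norm_num)
  calc Real.exp π * (C * (4 * (L ^ 25)⁻¹) * L ^ 9)
      = 4 * Real.exp π * C * ((L ^ 25)⁻¹ * L ^ 9) := by ring
    _ ≤ 4 * Real.exp π * C * (L ^ 15)⁻¹ := by gcongr

/-- `e^{−L} ≤ 15!·L⁻¹⁵` (`L > 0`). [cite: Zhang2022LandauSiegel, §12 p.70 (proof of Lemma 12.3, smoothing step)] -/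
theorem exp_neg_le_factorial_div {L : ℝ} (hL : 0 < L) :
    Real.exp (-L) ≤ (Nat.factorial 15 : ℝ) * (L ^ 15)⁻¹ := by
  have h := Real.pow_div_factorial_le_exp (x := L) hL.le 15
  have hpos : 0 < L ^ 15 / (Nat.factorial 15 : ℝ) := by positivity
  have h2 := one_div_le_one_div_of_le hpos h
  rw [Real.exp_neg, inv_eq_one_div]
  calc 1 / Real.exp L ≤ 1 / (L ^ 15 / (Nat.factorial 15 : ℝ)) := h2
    _ = (Nat.factorial 15 : ℝ) * (L ^ 15)⁻¹ := by field_simp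

/-- The off-window piece of the endgame: for `L ≥ 4` and `Λδ² ≥ L⁵⁰` (in the form `L¹⁰⁰ ≤ Λ`,
`δ = L⁻²⁵`): `½e^{−Λδ²}(e^{L⁹})^{45} ≤ ½·15!·L⁻¹⁵`. [cite: Zhang2022LandauSiegel, §12 p.70 (proof of Lemma 12.3, smoothing step)] -/
theorem offwindow_piece_le {L Λ : ℝ} (hL : 4 ≤ L) (hΛ : L ^ 100 ≤ Λ) :
    (1 / 2) * Real.exp (-(Λ * ((L ^ 25)⁻¹) ^ 2)) * (Real.exp (L ^ 9) ^ 3) ^ 15 ≤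
      (1 / 2) * ((Nat.factorial 15 : ℝ) * (L ^ 15)⁻¹) := by
  have hL1 : 1 ≤ L := by linarith
  have hL0 : 0 < L := by linarith
  have hP45 : (Real.exp (L ^ 9) ^ 3) ^ 15 = Real.exp (45 * L ^ 9) := by
    rw [← Real.exp_nat_mul, ← Real.exp_nat_mul]; congr 1; push_cast; ring_nf
  have hΛδ : L ^ 50 ≤ Λ * ((L ^ 25)⁻¹) ^ 2 := by
    have : L ^ 100 * ((L ^ 25)⁻¹) ^ 2 = L ^ 50 := by field_simp
    rw [← this]
    exact mul_le_mul_of_nonneg_right hΛ (by positivity)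
  have h50 : 45 * L ^ 9 + L ≤ L ^ 50 := by
    have h41 : (4 : ℝ) ^ 41 ≤ L ^ 41 := pow_le_pow_left₀ (by norm_num) hL 41
    have hL9 : 0 ≤ L ^ 9 := by positivity
    have hLL : L ≤ L ^ 9 := le_self_pow₀ hL1 (by norm_num)
    have h46 : (46 : ℝ) ≤ 4 ^ 41 := by norm_num
    calc 45 * L ^ 9 + L ≤ 45 * L ^ 9 + L ^ 9 := by linarith
      _ = 46 * L ^ 9 := by ring
      _ ≤ L ^ 41 * L ^ 9 := by nlinarith
      _ = L ^ 50 := by ring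
  rw [hP45, mul_assoc, ← Real.exp_add]
  apply mul_le_mul_of_nonneg_left _ (by norm_num)
  refine le_trans (Real.exp_le_exp.mpr ?_) (exp_neg_le_factorial_div hL0)
  linarith

/-- The tail piece of the endgame: `x⁻² ≤ 15!·L⁻¹⁵` once `e^{10L} ≤ x` (`L > 0`). [cite: Zhang2022LandauSiegel, §12 p.70 (proof of Lemma 12.3, smoothing step)] -/
theorem tail_piece_le {L x : ℝ} (hL : 0 < L) (hx : Real.exp (10 * L) ≤ x) :
    (x ^ 2)⁻¹ ≤ (Nat.factorial 15 : ℝ) * (L ^ 15)⁻¹ := by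
  refine le_trans ?_ (exp_neg_le_factorial_div hL)
  have hx0 : 0 < x := lt_of_lt_of_le (Real.exp_pos _) hx
  have : Real.exp L ≤ x ^ 2 := by
    have h1 : Real.exp L ≤ Real.exp (10 * L) := Real.exp_le_exp.mpr (by linarith)
    have h2 : x ≤ x ^ 2 := by
      have : 1 ≤ x := le_trans (Real.one_le_exp (by positivity)) hx
      nlinarith
    linarith
  rw [Real.exp_neg]
  exact (inv_le_inv₀ (by positivity) (Real.exp_pos L)).mpr this


end Literature.NumberTheory.LFunctions.Zhang2022.Typed.Sec12B
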